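import Mathlib
import Summits.ValiantsHypothesis.ValiantsHypothesis.Theorems.NewtonUnitEquationsDissociatedUniformTotalsLaw
import Summits.ValiantsHypothesis.ValiantsHypothesis.Theorems.NewtonUnitEquationsDissociatedUniformTotalsLawChartLevels
import Summits.ValiantsHypothesis.ValiantsHypothesis.Theorems.NewtonUnitEquationsDissociatedUniformTotalsLawChartLevelsTopSets
import Summits.ValiantsHypothesis.ValiantsHypothesis.Theorems.NewtonUnitEquationsDissociatedUniformTotalsLawTopKCells
import Summits.ValiantsHypothesis.ValiantsHypothesis.Theorems.NewtonUnitEquationsDissociatedUniformTotalsLawFibreDepthSets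
import Summits.ValiantsHypothesis.ValiantsHypothesis.Theorems.NewtonUnitEquationsDissociatedUniformTotalsLawDepthCells
import Literature.Computability.AlgebraicComplexity.NewtonPolygonTauProductBounds
import HarnessLib

/-!
# Crux `NewtonUnitEquations.DissociatedUniform` (stmt-ValiantsHypothesis-5905): totals law — the LOW LEVELS OF THE FIBRE ARRANGEMENT are linear in `|G|`

Deterministic companion of the average union law (`…TotalsLawAverageUnion`; memo `Cruxes/DissociatedUniform/NOTES-t1g12.md` §3).  The `|G|`
fibres `P_r = {a x + b (r - x)}` of a pair sumset form, along a half-chart `σ`, an arrangement of `|G|` convex support functions with up to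
`|G|²` vertices in total (`V_P = ∑_r V(P_r)`); its LEVEL-`≤ j` part consists of the fibre tops `(r, u)` — `u` the strict top of `P_r` at some
time — that have at most `j` fibres above them (`#aboveFib ≤ j`, `…TotalsLawFibreDepthSets`).  The located conjecture `FibreLevelBound` of
the memo asks for `O(j|G|)`; PROVED here, for injective `a, b` (points = letters), with a polynomial loss in `j`:

  `#{(r, u) : u the strict top of P_r at a time t ∉ T with ≤ j fibres above} ≤ (j+1)·(#T+1)·(j+1)²·((j+1)²+1)`   (`card_shallowFibreTops_le`)

for any `T ⊇` the low-event times of order `< j+1` of `A` and `B`, hence `≤ (j+1)(32|G|(j+1)+1)(j+1)²((j+1)²+1) = O(j⁶|G|)` off the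
`≤ 32|G|(j+1)` low-event times (`card_shallowFibreTops_le_poly`).  Proof: `(r, u) ↦ (u, aboveFib σ t u)` lands in the depth pairs of order
`≤ j` (`…TotalsLawDepthCells.card_depthPairs_le`), and a point of depth `≤ j` lies on at most `j + 1` fibres (`card_fibres_through_le`: its
left letters are among the top `j+1` of `A`, and the left letter determines the fibre when `b` is injective).
APPENDED (same session): the direct cell count `card_shallowFibreTops_le_cells` / `card_shallowFibreTops_le_poly'` —
`#shallowFibreTops_j(T) ≤ (#T+1)(j+1)³ ≤ (32|G|(j+1)+1)(j+1)³ = O(j⁴|G|)` (in a cell, `u ∈ topSum_j` and `r` is one of the `≤ j+1` fibres through `u`).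
APPENDED: the located sharp form typed as `@[conjecture] FibreLevelBound C` (`≤ C(j+1)|G|`, OPEN, located `C = 1`) and the proved polynomial
form `fibreLevelBound_poly` (`≤ 33(j+1)⁴|G|`).
Honest label: structure theorem on the pair system; `UnionVertBound`, `UnionTotalsLaw`, `TotalsLawThree` remain OPEN; nothing here bears on
VP ≠ VNP.
[folklore: levels in arrangements]
-/

set_option linter.dupNamespace false -- `ValiantsHypothesis.ValiantsHypothesis` (summit = problem) in every name

open scoped BigOperators Pointwise
open Matrix Finset

namespace Summit.ValiantsHypothesis.ValiantsHypothesis.Theorems.NewtonUnitEquationsDissociatedUniform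

namespace TotalsLaw

open Literature.Computability.AlgebraicComplexity.KPTT.PlanarMinkowski

section FibreLevels

variable {G : Type*} [AddCommGroup G] [Fintype G] [DecidableEq G]

open Classical in
/-- The SHALLOW FIBRE TOPS of order `≤ j` off the time set `T`: pairs `(r, u)` with `u` the strict top of the fibre `P_r` at some time `t ∉ T`
at which at most `j` fibres lie above `u` (the vertices of the level-`≤ j` part of the fibre arrangement along the chart `σ`). -/
noncomputable def shallowFibreTops (a b : G → (Fin 2 → ℝ)) (σ : ℝ) (j : ℕ) (T : Finset ℝ) : Finset (G × (Fin 2 → ℝ)) :=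
  ((Finset.univ : Finset G) ×ˢ sumFin a b).filter fun p =>
    ∃ t : ℝ, t ∉ T ∧ IsStrictTop ![σ, t] (fibFin a b p.1) p.2 ∧ (aboveFib a b σ t p.2).card ≤ j

omit [DecidableEq G] in
/-- **A shallow point lies on few fibres.**  If `a, b` are injective, `t` is not a low-event time of order `< j+1` of `A`, and the point `u`
has at most `j` fibres above it at time `t`, then `u` lies on at most `j + 1` fibres: the left letter of any spelling of `u` on `P_r` has rank
`≤ j` (`rank_le_card_aboveFib_left`), so it is one of the `≤ j+1` members of `topSet_A(j+1)`, and it determines `r`. [folklore] -/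
theorem card_fibres_through_le {a b : G → (Fin 2 → ℝ)} (ha : Function.Injective a) (hb : Function.Injective b) {σ t : ℝ} {j : ℕ}
    (hA : ∀ e : ℝ × ℝ, IsLowEvent σ (Finset.univ.image a) (j + 1) e → e.1 ≠ t) {u : Fin 2 → ℝ}
    (hd : (aboveFib a b σ t u).card ≤ j) :
    ((Finset.univ : Finset G).filter fun r => u ∈ fibFin a b r).card ≤ j + 1 := by
  classical
  -- choose a left letter for every fibre through `u`
  have hch : ∀ r ∈ (Finset.univ : Finset G).filter (fun r => u ∈ fibFin a b r), ∃ x : G, a x + b (r - x) = u := fun r hr =>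
    mem_fibFin.1 (Finset.mem_filter.1 hr).2
  choose! ξ hξ using hch
  calc ((Finset.univ : Finset G).filter fun r => u ∈ fibFin a b r).card
      ≤ (topSet σ (Finset.univ.image a) (j + 1) t).card := by
        refine Finset.card_le_card_of_injOn (fun r => a (ξ r)) (fun r hr => ?_) ?_
        · have hr' := Finset.mem_coe.1 hr
          have hu := hξ r hr'
          rw [Finset.mem_coe]
          unfold topSet
          refine Finset.mem_filter.2 ⟨Finset.mem_image.2 ⟨ξ r, Finset.mem_univ _, rfl⟩, ?_⟩
          have h := rank_le_card_aboveFib_left a b σ t (ξ r) (r - ξ r)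
          rw [hu] at h
          exact lt_of_le_of_lt (h.trans hd) (Nat.lt_succ_self j)
        · intro r hr r' hr' h
          have hrm := Finset.mem_coe.1 hr
          have hr'm := Finset.mem_coe.1 hr'
          have hx : ξ r = ξ r' := ha h
          have hu := hξ r hrm
          have hu' := hξ r' hr'm
          rw [hx] at hu
          have hbb : b (r - ξ r') = b (r' - ξ r') := by
            have := hu.trans hu'.symm
            exact add_left_cancel this
          have := hb hbb
          exact sub_left_injective this
    _ ≤ j + 1 := card_topSet_le_of_forall_ne hA

/-- **Low levels of the fibre arrangement are small.**  For injective `a, b` and `T` containing the low-event times of order `< j+1` of `A` and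
`B`: `#shallowFibreTops_j(T) ≤ (j+1)·((#T+1)·(j+1)²·((j+1)²+1))` — each shallow fibre top `(r, u)` yields the depth pair `(u, aboveFib σ t u)`
of order `≤ j` off `T` (`…DepthCells.card_depthPairs_le`), and at most `j+1` fibres pass through a shallow point. [folklore] -/
theorem card_shallowFibreTops_le {a b : G → (Fin 2 → ℝ)} (ha : Function.Injective a) (hb : Function.Injective b) {σ : ℝ} (j : ℕ)
    (T : Finset ℝ) (hTA : ∀ e : ℝ × ℝ, IsLowEvent σ (Finset.univ.image a) (j + 1) e → e.1 ∈ T)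
    (hTB : ∀ e : ℝ × ℝ, IsLowEvent σ (Finset.univ.image b) (j + 1) e → e.1 ∈ T) :
    (shallowFibreTops a b σ j T).card ≤ (j + 1) * ((T.card + 1) * ((j + 1) ^ 2 * ((j + 1) ^ 2 + 1))) := by
  classical
  -- a witness time for every shallow fibre top
  have hch : ∀ p ∈ shallowFibreTops a b σ j T,
      ∃ t : ℝ, t ∉ T ∧ IsStrictTop ![σ, t] (fibFin a b p.1) p.2 ∧ (aboveFib a b σ t p.2).card ≤ j := fun p hp =>
    (Finset.mem_filter.1 hp).2
  choose! τ hτ using hch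
  set f : G × (Fin 2 → ℝ) → (Fin 2 → ℝ) × Finset G := fun p => (p.2, aboveFib a b σ (τ p) p.2) with hf
  -- the image lies in the depth pairs
  have himg : (shallowFibreTops a b σ j T).image f ⊆ depthPairs a b σ j T := by
    intro q hq
    obtain ⟨p, hp, rfl⟩ := Finset.mem_image.1 hq
    obtain ⟨htT, -, hcard⟩ := hτ p hp
    have hpS : p.2 ∈ sumFin a b := (Finset.mem_product.1 (Finset.mem_filter.1 hp).1).2
    unfold depthPairs
    exact Finset.mem_filter.2 ⟨Finset.mem_product.2 ⟨hpS, Finset.mem_powerset.2 (Finset.subset_univ _)⟩,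
      τ p, htT, rfl, hcard⟩
  -- fibres of `f` have at most `j + 1` elements
  have hfib : ∀ q ∈ (shallowFibreTops a b σ j T).image f,
      ((shallowFibreTops a b σ j T).filter fun p => f p = q).card ≤ j + 1 := by
    intro q hq
    obtain ⟨p₀, hp₀, rfl⟩ := Finset.mem_image.1 hq
    obtain ⟨htT, -, hcard⟩ := hτ p₀ hp₀
    have hA : ∀ e : ℝ × ℝ, IsLowEvent σ (Finset.univ.image a) (j + 1) e → e.1 ≠ τ p₀ :=
      fun e he h => htT (h ▸ hTA e he)
    -- the fibre of `f` over `f p₀` projects injectively to the fibres through the point `p₀.2`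
    calc ((shallowFibreTops a b σ j T).filter fun p => f p = f p₀).card
        ≤ ((Finset.univ : Finset G).filter fun r => p₀.2 ∈ fibFin a b r).card := by
          refine Finset.card_le_card_of_injOn Prod.fst (fun p hp => ?_) ?_
          · obtain ⟨hpS, hpf⟩ := Finset.mem_filter.1 (Finset.mem_coe.1 hp)
            have h2 : p.2 = p₀.2 := by
              have := congrArg Prod.fst hpf
              simpa [hf] using this
            obtain ⟨-, htop, -⟩ := hτ p hpS
            rw [Finset.mem_coe]
            exact Finset.mem_filter.2 ⟨Finset.mem_univ _, h2 ▸ htop.mem⟩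
          · intro p hp p' hp' h
            obtain ⟨-, hpf⟩ := Finset.mem_filter.1 (Finset.mem_coe.1 hp)
            obtain ⟨-, hpf'⟩ := Finset.mem_filter.1 (Finset.mem_coe.1 hp')
            have h2 : p.2 = p'.2 := by
              have e1 := congrArg Prod.fst hpf
              have e2 := congrArg Prod.fst hpf'
              simp only [hf] at e1 e2
              rw [e1, e2]
            exact Prod.ext h h2
      _ ≤ j + 1 := card_fibres_through_le ha hb hA hcard
  calc (shallowFibreTops a b σ j T).card ≤ (j + 1) * ((shallowFibreTops a b σ j T).image f).card :=
        Finset.card_le_mul_card_image _ _ hfib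
    _ ≤ (j + 1) * (depthPairs a b σ j T).card := Nat.mul_le_mul_left _ (Finset.card_le_card himg)
    _ ≤ (j + 1) * ((T.card + 1) * ((j + 1) ^ 2 * ((j + 1) ^ 2 + 1))) :=
        Nat.mul_le_mul_left _ (card_depthPairs_le a b j T hTA hTB)

/-- **Low levels of the fibre arrangement are linear in `|G|` — polynomial form.**  For injective `a, b`, `σ ≠ 0` and any `T ⊇ lowTimes_j`:
`#shallowFibreTops_j(T) ≤ (j+1)(32|G|(j+1)+1)(j+1)²((j+1)²+1) = O(j⁶ |G|)`. [folklore] -/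
theorem card_shallowFibreTops_le_poly {a b : G → (Fin 2 → ℝ)} (ha : Function.Injective a) (hb : Function.Injective b) {σ : ℝ}
    (hσ : σ ≠ 0) (j : ℕ) (T : Finset ℝ) (hT : lowTimes a b σ j ⊆ T) :
    (shallowFibreTops a b σ j T).card ≤ (j + 1) * ((32 * Fintype.card G * (j + 1) + 1) * ((j + 1) ^ 2 * ((j + 1) ^ 2 + 1))) := by
  classical
  have hmono : shallowFibreTops a b σ j T ⊆ shallowFibreTops a b σ j (lowTimes a b σ j) := by
    intro p hp
    obtain ⟨hp1, t, htT, htop, hcard⟩ := Finset.mem_filter.1 hp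
    exact Finset.mem_filter.2 ⟨hp1, t, fun h => htT (hT h), htop, hcard⟩
  calc _ ≤ (shallowFibreTops a b σ j (lowTimes a b σ j)).card := Finset.card_le_card hmono
    _ ≤ (j + 1) * (((lowTimes a b σ j).card + 1) * ((j + 1) ^ 2 * ((j + 1) ^ 2 + 1))) :=
        card_shallowFibreTops_le ha hb j _ (fst_mem_lowTimes_left hσ) (fst_mem_lowTimes_right hσ)
    _ ≤ (j + 1) * ((32 * Fintype.card G * (j + 1) + 1) * ((j + 1) ^ 2 * ((j + 1) ^ 2 + 1))) :=
        Nat.mul_le_mul_left _ (Nat.mul_le_mul_right _ (Nat.succ_le_succ (card_lowTimes_le a b hσ j)))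

/-! ### Sharper count through the cells directly: `O(j⁴ |G|)` -/

/-- **Low levels of the fibre arrangement — cell count, `O(j⁴|G|)`.**  For injective `a, b` and `T ⊇` the low-event times of order `< j+1`
of `A` and `B`: `#shallowFibreTops_j(T) ≤ (#T + 1)·(j+1)³` — in a cell the shallow fibre tops `(r, u)` have `u` in the cell's `topSum_j`
(`≤ (j+1)²` points) and `r` among the `≤ j+1` fibres through `u`; no detour through the depth pairs. [folklore] -/
theorem card_shallowFibreTops_le_cells {a b : G → (Fin 2 → ℝ)} (ha : Function.Injective a) (hb : Function.Injective b) {σ : ℝ}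
    (j : ℕ) (T : Finset ℝ) (hTA : ∀ e : ℝ × ℝ, IsLowEvent σ (Finset.univ.image a) (j + 1) e → e.1 ∈ T)
    (hTB : ∀ e : ℝ × ℝ, IsLowEvent σ (Finset.univ.image b) (j + 1) e → e.1 ∈ T) :
    (shallowFibreTops a b σ j T).card ≤ (T.card + 1) * (j + 1) ^ 3 := by
  classical
  -- the shallow fibre tops witnessed in cell `i`
  set D : ℕ → Finset (G × (Fin 2 → ℝ)) := fun i => (shallowFibreTops a b σ j T).filter fun p =>
    ∃ t : ℝ, t ∉ T ∧ cellIdx T t = i ∧ IsStrictTop ![σ, t] (fibFin a b p.1) p.2 ∧ (aboveFib a b σ t p.2).card ≤ j with hD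
  have hcover : shallowFibreTops a b σ j T ⊆ (Finset.range (T.card + 1)).biUnion D := by
    intro p hp
    obtain ⟨-, t, htT, htop, hcard⟩ := Finset.mem_filter.1 hp
    rw [Finset.mem_biUnion]
    refine ⟨cellIdx T t, Finset.mem_range.2 (Nat.lt_succ_of_le (cellIdx_le_card T t)), ?_⟩
    rw [hD]
    exact Finset.mem_filter.2 ⟨hp, t, htT, rfl, htop, hcard⟩
  have hcell : ∀ i, (D i).card ≤ (j + 1) ^ 3 := by
    intro i
    by_cases hne : (D i).Nonempty
    swap
    · rw [Finset.not_nonempty_iff_eq_empty.1 hne, Finset.card_empty]; exact Nat.zero_le _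
    obtain ⟨p₀, hp₀⟩ := hne
    obtain ⟨-, t₀, ht₀T, ht₀i, -, -⟩ := Finset.mem_filter.1 hp₀
    set Q := topSum a b σ j t₀ with hQ
    have hQt : ∀ t : ℝ, t ∉ T → cellIdx T t = i → topSum a b σ j t = Q := by
      intro t htT hti
      rw [hQ]
      unfold topSum
      rw [topSet_eq_of_cellIdx_eq' hTA htT ht₀T (hti.trans ht₀i.symm),
        topSet_eq_of_cellIdx_eq' hTB htT ht₀T (hti.trans ht₀i.symm)]
    have hQcard : Q.card ≤ (j + 1) ^ 2 :=
      card_topSum_le (fun e he h => ht₀T (h ▸ hTA e he)) (fun e he h => ht₀T (h ▸ hTB e he))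
    -- `D i ⊆ Σ_{u ∈ Q} (fibres through u) × {u}`
    set img : Finset (G × (Fin 2 → ℝ)) :=
      Q.biUnion fun u => ((Finset.univ : Finset G).filter fun r => u ∈ fibFin a b r).image fun r => (r, u) with himg
    have hsub : D i ⊆ img := by
      intro p hp
      obtain ⟨hpS, t, htT, hti, htop, hcard⟩ := Finset.mem_filter.1 hp
      have huS : p.2 ∈ sumFin a b := (Finset.mem_product.1 (Finset.mem_filter.1 hpS).1).2
      have huQ : p.2 ∈ Q := hQt t htT hti ▸ mem_topSum_of_card_aboveFib_le huS hcard
      rw [himg, Finset.mem_biUnion]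
      refine ⟨p.2, huQ, Finset.mem_image.2 ⟨p.1, Finset.mem_filter.2 ⟨Finset.mem_univ _, htop.mem⟩, ?_⟩⟩
      exact Prod.ext rfl rfl
    -- each `u ∈ Q` lies on `≤ j + 1` fibres (witness time of any shallow top over `u` in this cell; else the filter is still bounded via `t₀`?)
    have hfib : ∀ u ∈ Q, (((Finset.univ : Finset G).filter fun r => u ∈ fibFin a b r).image fun r => (r, u)).card ≤ j + 1 ∨
        ∀ p ∈ D i, p.2 ≠ u := by
      intro u hu
      by_cases hex : ∃ p ∈ D i, p.2 = u
      · left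
        obtain ⟨p, hp, hpu⟩ := hex
        obtain ⟨-, t, htT, hti, -, hcard⟩ := Finset.mem_filter.1 hp
        rw [hpu] at hcard
        have hA : ∀ e : ℝ × ℝ, IsLowEvent σ (Finset.univ.image a) (j + 1) e → e.1 ≠ t :=
          fun e he h => htT (h ▸ hTA e he)
        exact Finset.card_image_le.trans (card_fibres_through_le ha hb hA hcard)
      · right
        push Not at hex
        exact hex
    -- refine the cover to the `u` that actually occur
    set img' : Finset (G × (Fin 2 → ℝ)) :=
      (Q.filter fun u => ∃ p ∈ D i, p.2 = u).biUnion fun u =>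
        ((Finset.univ : Finset G).filter fun r => u ∈ fibFin a b r).image fun r => (r, u) with himg'
    have hsub' : D i ⊆ img' := by
      intro p hp
      have hpimg := hsub hp
      rw [himg, Finset.mem_biUnion] at hpimg
      obtain ⟨u, huQ, hpu⟩ := hpimg
      obtain ⟨r, -, hru⟩ := Finset.mem_image.1 hpu
      have hp2 : p.2 = u := by rw [← hru]
      rw [himg', Finset.mem_biUnion]
      exact ⟨u, Finset.mem_filter.2 ⟨huQ, p, hp, hp2⟩, hpu⟩
    calc (D i).card ≤ img'.card := Finset.card_le_card hsub'
      _ ≤ ∑ u ∈ Q.filter (fun u => ∃ p ∈ D i, p.2 = u),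
            (((Finset.univ : Finset G).filter fun r => u ∈ fibFin a b r).image fun r => (r, u)).card := Finset.card_biUnion_le
      _ ≤ ∑ _u ∈ Q.filter (fun u => ∃ p ∈ D i, p.2 = u), (j + 1) := by
          refine Finset.sum_le_sum fun u hu => ?_
          obtain ⟨huQ, hex⟩ := Finset.mem_filter.1 hu
          rcases hfib u huQ with h | h
          · exact h
          · obtain ⟨p, hp, hpu⟩ := hex
            exact absurd hpu (h p hp)
      _ = (Q.filter fun u => ∃ p ∈ D i, p.2 = u).card * (j + 1) := by rw [Finset.sum_const, smul_eq_mul]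
      _ ≤ (j + 1) ^ 2 * (j + 1) := Nat.mul_le_mul_right _ ((Finset.card_filter_le _ _).trans hQcard)
      _ = (j + 1) ^ 3 := by ring
  calc (shallowFibreTops a b σ j T).card ≤ ((Finset.range (T.card + 1)).biUnion D).card := Finset.card_le_card hcover
    _ ≤ ∑ i ∈ Finset.range (T.card + 1), (D i).card := Finset.card_biUnion_le
    _ ≤ ∑ _i ∈ Finset.range (T.card + 1), (j + 1) ^ 3 := Finset.sum_le_sum fun i _ => hcell i
    _ = (T.card + 1) * (j + 1) ^ 3 := by rw [Finset.sum_const, Finset.card_range, smul_eq_mul]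

/-- **`O(j⁴|G|)` form**: for injective `a, b`, `σ ≠ 0`, any `T ⊇ lowTimes_j`: `#shallowFibreTops_j(T) ≤ (32|G|(j+1)+1)(j+1)³`. [folklore] -/
theorem card_shallowFibreTops_le_poly' {a b : G → (Fin 2 → ℝ)} (ha : Function.Injective a) (hb : Function.Injective b) {σ : ℝ}
    (hσ : σ ≠ 0) (j : ℕ) (T : Finset ℝ) (hT : lowTimes a b σ j ⊆ T) :
    (shallowFibreTops a b σ j T).card ≤ (32 * Fintype.card G * (j + 1) + 1) * (j + 1) ^ 3 := by
  classical
  have hmono : shallowFibreTops a b σ j T ⊆ shallowFibreTops a b σ j (lowTimes a b σ j) := by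
    intro p hp
    obtain ⟨hp1, t, htT, htop, hcard⟩ := Finset.mem_filter.1 hp
    exact Finset.mem_filter.2 ⟨hp1, t, fun h => htT (hT h), htop, hcard⟩
  calc _ ≤ (shallowFibreTops a b σ j (lowTimes a b σ j)).card := Finset.card_le_card hmono
    _ ≤ ((lowTimes a b σ j).card + 1) * (j + 1) ^ 3 :=
        card_shallowFibreTops_le_cells ha hb j _ (fst_mem_lowTimes_left hσ) (fst_mem_lowTimes_right hσ)
    _ ≤ (32 * Fintype.card G * (j + 1) + 1) * (j + 1) ^ 3 :=
        Nat.mul_le_mul_right _ (Nat.succ_le_succ (card_lowTimes_le a b hσ j))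

/-! ### The located sharp form, typed (OPEN): `FibreLevelBound C` -/

/-- **The fibre level bound with constant `C`** (conjecture-grade, OPEN; memo `Cruxes/DissociatedUniform/NOTES-t1g12.md` §3; census
`C_{≤k}/(k|G|) ≤ 0.35` for `k ≤ 12`, `q = 23`, so `C = 1` is the located value): for injective `a, b`, every half-chart `σ ≠ 0`, every order
`j` and every finite time set `T ⊇ lowTimes_j`, the level-`≤ j` part of the fibre arrangement has at most `C·(j+1)·|G|` vertices.  PROVED with
`(j+1)` replaced by `33(j+1)⁴` (`fibreLevelBound_poly`); follows from `UnionVertBound` by Clarkson–Shor sampling (memo §3, paper).  Not asserted. -/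
@[conjecture] def FibreLevelBound (C : ℕ) : Prop :=
  ∀ (G : Type) [AddCommGroup G] [Fintype G] [DecidableEq G] (a b : G → (Fin 2 → ℝ)), Function.Injective a → Function.Injective b →
    ∀ (σ : ℝ), σ ≠ 0 → ∀ (j : ℕ) (T : Finset ℝ), lowTimes a b σ j ⊆ T →
      (shallowFibreTops a b σ j T).card ≤ C * (j + 1) * Fintype.card G

/-- Monotonicity in the constant. -/
theorem fibreLevelBound_mono {C C' : ℕ} (hCC' : C ≤ C') (h : FibreLevelBound C) : FibreLevelBound C' := by
  intro G _ _ _ a b ha hb σ hσ j T hT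
  exact (h G a b ha hb σ hσ j T hT).trans (Nat.mul_le_mul_right _ (Nat.mul_le_mul_right _ hCC'))

/-- **The polynomial form that IS proved**: `#shallowFibreTops_j(T) ≤ 33·(j+1)⁴·|G|` (from `card_shallowFibreTops_le_poly'`, using
`32|G|(j+1) + 1 ≤ 33|G|(j+1)`). [folklore] -/
theorem fibreLevelBound_poly {G : Type*} [AddCommGroup G] [Fintype G] [DecidableEq G] {a b : G → (Fin 2 → ℝ)}
    (ha : Function.Injective a) (hb : Function.Injective b) {σ : ℝ} (hσ : σ ≠ 0) (j : ℕ) (T : Finset ℝ) (hT : lowTimes a b σ j ⊆ T) :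
    (shallowFibreTops a b σ j T).card ≤ 33 * (j + 1) ^ 4 * Fintype.card G := by
  have hq : 1 ≤ Fintype.card G := Fintype.card_pos
  have h1 : 32 * Fintype.card G * (j + 1) + 1 ≤ 33 * Fintype.card G * (j + 1) := by nlinarith
  calc (shallowFibreTops a b σ j T).card ≤ (32 * Fintype.card G * (j + 1) + 1) * (j + 1) ^ 3 :=
        card_shallowFibreTops_le_poly' ha hb hσ j T hT
    _ ≤ (33 * Fintype.card G * (j + 1)) * (j + 1) ^ 3 := Nat.mul_le_mul_right _ h1
    _ = 33 * (j + 1) ^ 4 * Fintype.card G := by ring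

end FibreLevels

end TotalsLaw

end Summit.ValiantsHypothesis.ValiantsHypothesis.Theorems.NewtonUnitEquationsDissociatedUniform
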